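import Literature.Geometry.Lorentzian.KerrSchildSlabDivergence
import HarnessLib

/-!
# The integrated divergence identity between two graph hypersurfaces `{t = τ + F₁(y)}`,
# `{t = τ + F₂(y)}` for `C¹` currents on `ℝ⁴` vanishing on the far part of the wedge

(family `gr`; infrastructure for the physical-space multiplier estimates behind statement
**gr.S24** — Dafermos–Rodnianski–Shlapentokh-Rothman, arXiv:1402.7034, §2.3.2 — in the
coefficient-field framework of `KerrSchild.waveOperator`; namespace
`Literature.Geometry.Lorentzian.E4`)

Dafermos–Rodnianski–Shlapentokh-Rothman (arXiv:1402.7034 = Ann. of Math. 183 (2016)), §2.3.2,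
apply the divergence identity (ingeneralform),
`∫_{S⁺} J_μ n^μ + ∫_𝓑 ∇^μ J_μ = ∫_{S⁻} J_μ n^μ`, between the leaves `Σ_τ = φ_τ(Σ_0)` of their
foliation and more generally (§3.3) between admissible hypersurfaces; in the ingoing Kerr–Schild
chart these are graphs `{t* = τ + F(y)}` over (part of) `E3` (`KerrWaveEnergy.lean`,
`Kerr.IsAdmissibleHeight`; `KerrEnergyIdentity.lean`, `Kerr.graphConormal F y = (1, −∂₁F, −∂₂F,
−∂₃F)` the conormal `dt* − dF`). In a chart with `det g = −1` the divergence is the coordinate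
one and `dVol = dt dy`, and the flux of a vector field `J = (J^μ)` through the graph of `τ + F`,
pulled back to `E3`, is `∑_μ J^μ(τ + F(y), y) n_μ(y) dy` with `n = dt − dF`.

This file proves the identity in this form for an **arbitrary** `C¹` current
`J : ℝ⁴ → ℝ⁴`, two `C²` heights `F₁ ≤ F₂` and any `τ`, assuming only that `J` vanishes on the far
part `{‖y‖ > ρ}` of the closed wedge `{τ + F₁(y) ≤ t ≤ τ + F₂(y)}` between the graphs (as is the
case for the currents `J^V[Ψ]` of a `Ψ` "compactly supported in `𝓡(0, τ)`", loc. cit.):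

* `E4.graphFlux_sub_eq_integral_divergence` —
  `∫ ∑_μ J^μ n^{F₂}_μ (τ + F₂(y), y) dy − ∫ ∑_μ J^μ n^{F₁}_μ (τ + F₁(y), y) dy
     = ∫_{θ ∈ (0,1]} ∫ (F₂ − F₁)(y) (∑_μ ∂_μ J^μ)(τ + F₁(y) + θ (F₂ − F₁)(y), y) dy dθ`;
* `E4.graphFlux_sub_eq_integral_integral` — the same with the right-hand side written as the
  space-time integral over the wedge, `∫ ( ∫_{t ∈ (τ + F₁(y), τ + F₂(y)]} (∑_μ ∂_μ J^μ)(t, y) dt ) dy`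
  (Fubini and the substitution `t = τ + F₁(y) + θ (F₂ − F₁)(y)` in the inner integral);
* `E4.graphFlux_translate_sub_eq_integral_integral` — the special case `F₂ = F₁ + h`, `h ≥ 0`: the
  flux through `{t = τ + h + F}` minus the flux through `{t = τ + F}` is the integral of the
  divergence over `{τ + F(y) < t ≤ τ + h + F(y)}` — the region `𝓡(τ, τ + h)` between two leaves
  `Σ_τ = {t* = τ + F}` of a `φ_τ`-invariant graph foliation (DRSR §2.3.2, (ingeneralform2)
  without the horizon term, for currents supported away from the lateral boundary).

The proof is a reduction to the slab identity `E4.integral_sub_eq_integral_divergence` of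
`KerrSchildSlabDivergence.lean` by the **Piola transform** along the diffeomorphism
`Ψ(θ, y) = (τ + F₁(y) + θ G(y), y)`, `G = F₂ − F₁ ≥ 0`, of Jacobian `G(y)`: the field
`J̃ = (J̃^θ, J̃^i) = (J⁰∘Ψ − ∑_i ∂_i(F₁ + θG) J^i∘Ψ, G · J^i∘Ψ)` on `ℝ × E3 = E4` is `C¹`, its
`θ`-component on the slice `{θ = c}` is the flux density of `J` through the graph of
`τ + F₁ + cG`, it vanishes for `‖y‖ > ρ`, `θ ∈ [0,1]`, and
`∑_ν ∂_ν J̃^ν (θ, y) = G(y) (∑_μ ∂_μ J^μ)(Ψ(θ, y))` (the chain rules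
`Kerr.fderiv_comp_graphMap`, `E4.hasDerivAt_graphMap_param` of `KerrEnergyIdentity.lean`; this
is the identity `Kerr.graphFluxDeriv_eq` there, for a general current). For the energy currents
`(J^X)^μ = T^μ{}_ν X^ν` of `KerrSchildMultiplierCurrent.lean` the *energy* through a graph is
`−∑_μ (J^X)^μ n_μ ≥ 0` (cf. `Kerr.graphFluxDensity`), so the identity reads
`E_{F₂} + ∫_{wedge} ((□_G w) X(w) + K^X) = E_{F₁}`, which is (ingeneralform) as printed.

## References

* M. Dafermos, I. Rodnianski, Y. Shlapentokh-Rothman, arXiv:1402.7034 = Ann. of Math. 183 (2016),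
  §2.3.2 ((ingeneralform), (ingeneralform2)), §3.3 (admissible hypersurfaces as graphs)
  (key `DafermosRodnianskiShlapentokhrothman2014`).
* M. Dafermos, I. Rodnianski, *Lectures on black holes and linear waves*, arXiv:0811.0354, App. D
  (the divergence theorem for `J^V`) (key `DafermosRodnianski2008`).
-/

noncomputable section

open Set Filter
open scoped ContDiff Topology

namespace Literature.Geometry.Lorentzian

open _root_.MeasureTheory Metric

namespace E4

/-- Chain rule along a slice: `∂_{y_i} [J(t, y)] = (∂_{i+1} J)(t, y)` (a copy of the private lemma
of `KerrSchildEnergyEstimate.lean`). [folklore] -/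
private theorem fderiv_comp_ofTimeSpace_single₂ {J : E4 → ℝ} {t : ℝ} {y : E3}
    (hJ : DifferentiableAt ℝ J (ofTimeSpace t y)) (i : Fin 3) :
    fderiv ℝ (fun y ↦ J (ofTimeSpace t y)) y (EuclideanSpace.single i 1) =
      fderiv ℝ J (ofTimeSpace t y) (basisVector i.succ) := by
  have h : HasFDerivAt (fun y ↦ J (ofTimeSpace t y)) ((fderiv ℝ J (ofTimeSpace t y)).comp spaceEmbed)
      y := hJ.hasFDerivAt.comp y (hasFDerivAt_ofTimeSpace t y)
  have hs : spaceEmbed (EuclideanSpace.single i 1) = basisVector i.succ := by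
    ext j
    refine Fin.cases ?_ (fun k ↦ ?_) j
    · simp [basisVector, Fin.succ_ne_zero]
    · simp [basisVector, Fin.succ_inj]
  rw [h.fderiv, ContinuousLinearMap.comp_apply, hs]

/-- The graph map of the family `θ ↦ τ + F₁ + θ G` has `θ`-derivative `G(y) ∂_{t*}` (the case
`κ = id` of `E4.hasDerivAt_graphMap_param`). [folklore] -/
theorem hasDerivAt_graphMap_param_id (F₁ G : E3 → ℝ) (τ : ℝ) (y : E3) (θ : ℝ) :
    HasDerivAt (fun ϑ : ℝ ↦ ofTimeSpace (τ + (F₁ y + ϑ * G y)) y) ((G y) • basisVector 0) θ := by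
  have h := hasDerivAt_graphMap_param F₁ G (hasDerivAt_id θ) τ y
  simpa using h

/-- Chain rule in the height parameter for `κ = id`: `∂_θ [J(τ + F₁(y) + θG(y), y)] =
G(y) ∂₀J (τ + F₁(y) + θG(y), y)`. [folklore] -/
theorem hasDerivAt_comp_graphMap_param_id {J : E4 → ℝ} (F₁ G : E3 → ℝ) (τ : ℝ) (y : E3)
    {θ : ℝ} (hJ : DifferentiableAt ℝ J (ofTimeSpace (τ + (F₁ y + θ * G y)) y)) :
    HasDerivAt (fun ϑ : ℝ ↦ J (ofTimeSpace (τ + (F₁ y + ϑ * G y)) y))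
      (G y * fderiv ℝ J (ofTimeSpace (τ + (F₁ y + θ * G y)) y) (basisVector 0)) θ := by
  have h := hJ.hasFDerivAt.comp_hasDerivAt (f := fun ϑ : ℝ ↦ ofTimeSpace (τ + (F₁ y + ϑ * G y)) y)
    θ (hasDerivAt_graphMap_param_id F₁ G τ y θ)
  refine h.congr_deriv ?_
  rw [map_smul, smul_eq_mul]

/-- **The integrated divergence identity between two graph hypersurfaces** (DRSR
arXiv:1402.7034, §2.3.2, (ingeneralform), in a chart with `det g = −1`). Let `J = (J^μ)_{μ<4}` be
`C¹` functions on `ℝ⁴`, `F₁ ≤ F₂` two `C²` height functions on `E3`, `τ ∈ ℝ`, and assume `J`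
vanishes at every point `(t, y)` of the closed wedge `τ + F₁(y) ≤ t ≤ τ + F₂(y)` with `‖y‖ > ρ`.
Then, with `n^F = dt − dF = (1, −∂₁F, −∂₂F, −∂₃F)` (`Kerr.graphConormal`),
`∫ ∑_μ J^μ(τ + F₂(y), y) n^{F₂}_μ(y) dy − ∫ ∑_μ J^μ(τ + F₁(y), y) n^{F₁}_μ(y) dy
  = ∫_{θ ∈ (0,1]} ∫ (F₂ − F₁)(y) (∑_μ ∂_μ J^μ)(τ + F₁(y) + θ(F₂ − F₁)(y), y) dy dθ`.
Proof: Piola transform `J̃ = (J⁰∘Ψ − ∑_i ∂_i(F₁ + θG) J^i∘Ψ, G J^i∘Ψ)` along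
`Ψ(θ, y) = (τ + F₁(y) + θG(y), y)`, `G = F₂ − F₁`, for which
`∑_ν ∂_ν J̃^ν = G (∑_μ ∂_μ J^μ)∘Ψ`, and the slab identity
`E4.integral_sub_eq_integral_divergence` on `[0, 1] × E3`.
[cite: DafermosRodnianskiShlapentokhrothman2014, §2.3.2] -/
theorem graphFlux_sub_eq_integral_divergence {J : Fin 4 → E4 → ℝ}
    (hJ1 : ∀ μ, ContDiff ℝ 1 (J μ)) {F₁ F₂ : E3 → ℝ} (hF₁ : ContDiff ℝ 2 F₁)
    (hF₂ : ContDiff ℝ 2 F₂) (hle : ∀ y, F₁ y ≤ F₂ y) {τ ρ : ℝ}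
    (hJ0 : ∀ μ (x : E4), ρ < E4.spatialNorm x → τ + F₁ (E4.spatial x) ≤ x 0 →
      x 0 ≤ τ + F₂ (E4.spatial x) → J μ x = 0) :
    (∫ y, ∑ μ, J μ (E4.ofTimeSpace (τ + F₂ y) y) * Kerr.graphConormal F₂ y μ) -
        ∫ y, ∑ μ, J μ (E4.ofTimeSpace (τ + F₁ y) y) * Kerr.graphConormal F₁ y μ =
      ∫ θ in Set.Ioc (0 : ℝ) 1, ∫ y, (F₂ y - F₁ y) *
        ∑ μ, fderiv ℝ (J μ) (E4.ofTimeSpace (τ + (F₁ y + θ * (F₂ y - F₁ y))) y)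
          (E4.basisVector μ) := by
  -- ### the difference of the heights
  obtain ⟨G, hG⟩ : ∃ G : E3 → ℝ, ∀ y, G y = F₂ y - F₁ y := ⟨_, fun _ ↦ rfl⟩
  have hGfun : G = fun y ↦ F₂ y - F₁ y := funext hG
  have hG2 : ContDiff ℝ 2 G := by rw [hGfun]; exact hF₂.sub hF₁
  have hG0 : ∀ y, 0 ≤ G y := fun y ↦ by rw [hG]; exact sub_nonneg.mpr (hle y)
  have hF₁1 : ContDiff ℝ 1 F₁ := hF₁.of_le one_le_two
  have hG1 : ContDiff ℝ 1 G := hG2.of_le one_le_two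
  have hF₁d : ∀ y, DifferentiableAt ℝ F₁ y := fun y ↦ (hF₁.differentiable two_ne_zero) y
  have hGd : ∀ y, DifferentiableAt ℝ G y := fun y ↦ (hG2.differentiable two_ne_zero) y
  have hJd : ∀ μ x, DifferentiableAt ℝ (J μ) x := fun μ x ↦ (hJ1 μ).differentiable one_ne_zero x
  have hF₂fun : F₂ = fun z ↦ F₁ z + 1 * G z := funext fun z ↦ by rw [hG]; ring
  simp only [← hG]
  -- ### the graph map `Ψ` of the family on `E4 ∋ (θ, y)` and the Piola-transformed current
  obtain ⟨P, hP⟩ : ∃ P : E4 → E4, ∀ x, P x =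
      E4.ofTimeSpace (τ + (F₁ (E4.spatial x) + x 0 * G (E4.spatial x))) (E4.spatial x) :=
    ⟨_, fun _ ↦ rfl⟩
  obtain ⟨Jt, hJt0, hJts⟩ : ∃ Jt : Fin 4 → E4 → ℝ,
      (∀ x, Jt 0 x = J 0 (P x) - ∑ i : Fin 3, J i.succ (P x) *
        (Kerr.partialE3 F₁ (E4.spatial x) i + x 0 * Kerr.partialE3 G (E4.spatial x) i)) ∧
      (∀ (i : Fin 3) x, Jt i.succ x = G (E4.spatial x) * J i.succ (P x)) :=
    ⟨fun μ x ↦ Fin.cases (J 0 (P x) - ∑ i : Fin 3, J i.succ (P x) *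
        (Kerr.partialE3 F₁ (E4.spatial x) i + x 0 * Kerr.partialE3 G (E4.spatial x) i))
        (fun i ↦ G (E4.spatial x) * J i.succ (P x)) μ, fun _ ↦ rfl, fun _ _ ↦ rfl⟩
  -- ### regularity: `Jt` is `C¹`
  have hsp : ContDiff ℝ 1 (fun x : E4 ↦ E4.spatial x) := E4.spatial.contDiff
  have hx0 : ContDiff ℝ 1 (fun x : E4 ↦ x 0) := (E4.dx 0).contDiff
  have hP1 : ContDiff ℝ 1 P := by
    have h : P = fun x ↦ (τ + (F₁ (E4.spatial x) + x 0 * G (E4.spatial x))) • E4.basisVector 0 +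
        E4.spaceEmbed (E4.spatial x) := funext fun x ↦ by rw [hP, E4.ofTimeSpace_eq_smul_add']
    rw [h]
    exact ((contDiff_const.add ((hF₁1.comp hsp).add (hx0.mul (hG1.comp hsp)))).smul
      contDiff_const).add (E4.spaceEmbed.contDiff.comp hsp)
  have hJP1 : ∀ μ, ContDiff ℝ 1 (fun x ↦ J μ (P x)) := fun μ ↦ (hJ1 μ).comp hP1
  have hdF₁c : ∀ i, ContDiff ℝ 1 (fun x : E4 ↦ Kerr.partialE3 F₁ (E4.spatial x) i) := fun i ↦
    ((hF₁.fderiv_right (m := 1) le_rfl).clm_apply contDiff_const).comp hsp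
  have hdGc : ∀ i, ContDiff ℝ 1 (fun x : E4 ↦ Kerr.partialE3 G (E4.spatial x) i) := fun i ↦
    ((hG2.fderiv_right (m := 1) le_rfl).clm_apply contDiff_const).comp hsp
  have hJt1 : ∀ μ, ContDiff ℝ 1 (Jt μ) := by
    intro μ
    refine Fin.cases ?_ (fun i ↦ ?_) μ
    · have h : Jt 0 = fun x ↦ J 0 (P x) - ∑ i : Fin 3, J i.succ (P x) *
          (Kerr.partialE3 F₁ (E4.spatial x) i + x 0 * Kerr.partialE3 G (E4.spatial x) i) :=
        funext (hJt0 ·)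
      rw [h]
      exact (hJP1 0).sub (ContDiff.sum fun i _ ↦ (hJP1 i.succ).mul
        ((hdF₁c i).add (hx0.mul (hdGc i))))
    · have h : Jt i.succ = fun x ↦ G (E4.spatial x) * J i.succ (P x) := funext (hJts i ·)
      rw [h]
      exact (hG1.comp hsp).mul (hJP1 i.succ)
  have hJtd : ∀ μ x, DifferentiableAt ℝ (Jt μ) x := fun μ x ↦ (hJt1 μ).differentiable one_ne_zero x
  -- ### values on the slices `{θ = const}`
  have hPslice : ∀ (θ : ℝ) (y : E3), P (E4.ofTimeSpace θ y) =
      E4.ofTimeSpace (τ + (F₁ y + θ * G y)) y := fun θ y ↦ by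
    rw [hP, E4.spatial_ofTimeSpace, E4.ofTimeSpace_apply_zero]
  have hJt0_slice : ∀ (θ : ℝ) (y : E3), Jt 0 (E4.ofTimeSpace θ y) =
      J 0 (E4.ofTimeSpace (τ + (F₁ y + θ * G y)) y) -
        ∑ i : Fin 3, J i.succ (E4.ofTimeSpace (τ + (F₁ y + θ * G y)) y) *
          (Kerr.partialE3 F₁ y i + θ * Kerr.partialE3 G y i) := fun θ y ↦ by
    rw [hJt0, hPslice, E4.spatial_ofTimeSpace, E4.ofTimeSpace_apply_zero]
  have hJts_slice : ∀ (i : Fin 3) (θ : ℝ) (y : E3), Jt i.succ (E4.ofTimeSpace θ y) =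
      G y * J i.succ (E4.ofTimeSpace (τ + (F₁ y + θ * G y)) y) := fun i θ y ↦ by
    rw [hJts, hPslice, E4.spatial_ofTimeSpace]
  -- ### vanishing of `J` at the graph points of the family over `‖y‖ > ρ`, `θ ∈ [0, 1]`
  have hJ0' : ∀ μ, ∀ θ ∈ Set.Icc (0 : ℝ) 1, ∀ y : E3, ρ < ‖y‖ →
      J μ (E4.ofTimeSpace (τ + (F₁ y + θ * G y)) y) = 0 := by
    intro μ θ hθ y hy
    refine hJ0 μ _ (by rwa [E4.spatialNorm_ofTimeSpace]) ?_ ?_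
    · rw [E4.spatial_ofTimeSpace, E4.ofTimeSpace_apply_zero]
      nlinarith [mul_nonneg hθ.1 (hG0 y)]
    · rw [E4.spatial_ofTimeSpace, E4.ofTimeSpace_apply_zero]
      have h1 : θ * G y ≤ G y := mul_le_of_le_one_left (hG0 y) hθ.2
      have h2 : G y = F₂ y - F₁ y := hG y
      linarith
  have hJt_zero : ∀ μ, ∀ θ ∈ Set.Icc (0 : ℝ) 1, ∀ y : E3, ρ < ‖y‖ →
      Jt μ (E4.ofTimeSpace θ y) = 0 := by
    intro μ θ hθ y hy
    refine Fin.cases ?_ (fun i ↦ ?_) μ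
    · rw [hJt0_slice]
      simp [hJ0' _ θ hθ y hy]
    · rw [hJts_slice, hJ0' _ θ hθ y hy, mul_zero]
  -- ### the Piola identity `∑_ν ∂_ν J̃^ν (θ, y) = G(y) (∑_μ ∂_μ J^μ)(Ψ(θ, y))`
  have hpiola : ∀ (θ : ℝ) (y : E3),
      ∑ ν, fderiv ℝ (Jt ν) (E4.ofTimeSpace θ y) (E4.basisVector ν) =
        G y * ∑ μ, fderiv ℝ (J μ) (E4.ofTimeSpace (τ + (F₁ y + θ * G y)) y)
          (E4.basisVector μ) := by
    intro θ y
    -- name the atoms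
    obtain ⟨a, ha⟩ : ∃ a : Fin 3 → ℝ, ∀ i, Kerr.partialE3 F₁ y i = a i := ⟨_, fun _ ↦ rfl⟩
    obtain ⟨b, hb⟩ : ∃ b : Fin 3 → ℝ, ∀ i, Kerr.partialE3 G y i = b i := ⟨_, fun _ ↦ rfl⟩
    obtain ⟨Q, hQ⟩ : ∃ Q : ℝ → E4, ∀ ϑ, Q ϑ = E4.ofTimeSpace (τ + (F₁ y + ϑ * G y)) y :=
      ⟨_, fun _ ↦ rfl⟩
    -- the time derivative `∂_θ J̃^θ`
    have htime : fderiv ℝ (Jt 0) (E4.ofTimeSpace θ y) (E4.basisVector 0) =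
        G y * fderiv ℝ (J 0) (Q θ) (E4.basisVector 0) -
          ∑ i : Fin 3, (G y * fderiv ℝ (J i.succ) (Q θ) (E4.basisVector 0) * (a i + θ * b i) +
            J i.succ (Q θ) * b i) := by
      -- chain rule: `∂_0 (Jt 0)(θ, y)` is the derivative of `ϑ ↦ Jt 0 (ϑ, y)`
      have h1 : HasDerivAt (fun ϑ : ℝ ↦ Jt 0 (E4.ofTimeSpace ϑ y))
          (fderiv ℝ (Jt 0) (E4.ofTimeSpace θ y) (E4.basisVector 0)) θ :=
        (hJtd 0 _).hasFDerivAt.comp_hasDerivAt θ (E4.hasDerivAt_ofTimeSpace_left θ y)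
      -- explicit derivative of the same function
      have hfun : (fun ϑ : ℝ ↦ Jt 0 (E4.ofTimeSpace ϑ y)) = fun ϑ ↦ J 0 (Q ϑ) -
          ∑ i : Fin 3, J i.succ (Q ϑ) * (a i + ϑ * b i) := by
        funext ϑ
        rw [hJt0_slice, hQ]
        simp only [ha, hb]
      have hJQ : ∀ μ, HasDerivAt (fun ϑ : ℝ ↦ J μ (Q ϑ))
          (G y * fderiv ℝ (J μ) (Q θ) (E4.basisVector 0)) θ := by
        intro μ
        have h := hasDerivAt_comp_graphMap_param_id (J := J μ) F₁ G τ y (θ := θ) (hJd μ _)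
        rw [hQ]
        refine HasDerivAt.congr_of_eventuallyEq h (Filter.Eventually.of_forall fun ϑ ↦ ?_)
        simp only [hQ]
      have hlin : ∀ i : Fin 3, HasDerivAt (fun ϑ : ℝ ↦ a i + ϑ * b i) (b i) θ := fun i ↦ by
        simpa using ((hasDerivAt_id θ).mul_const (b i)).const_add (a i)
      have h2 : HasDerivAt (fun ϑ : ℝ ↦ Jt 0 (E4.ofTimeSpace ϑ y))
          (G y * fderiv ℝ (J 0) (Q θ) (E4.basisVector 0) -
            ∑ i : Fin 3, (G y * fderiv ℝ (J i.succ) (Q θ) (E4.basisVector 0) * (a i + θ * b i) +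
              J i.succ (Q θ) * b i)) θ := by
        rw [hfun]
        exact (hJQ 0).sub (HasDerivAt.sum fun i (_ : i ∈ Finset.univ) ↦ (hJQ i.succ).mul (hlin i))
      exact h1.unique h2
    -- the spatial derivatives `∂_{y_i} J̃^i`
    have hspace : ∀ i : Fin 3,
        fderiv ℝ (Jt i.succ) (E4.ofTimeSpace θ y) (E4.basisVector i.succ) =
          b i * J i.succ (Q θ) + G y * ((a i + θ * b i) *
            fderiv ℝ (J i.succ) (Q θ) (E4.basisVector 0) +
              fderiv ℝ (J i.succ) (Q θ) (E4.basisVector i.succ)) := by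
      intro i
      rw [← fderiv_comp_ofTimeSpace_single₂ (hJtd _ _) i]
      have hfun : (fun z : E3 ↦ Jt i.succ (E4.ofTimeSpace θ z)) =
          fun z ↦ G z * J i.succ (E4.ofTimeSpace (τ + (F₁ z + θ * G z)) z) :=
        funext fun z ↦ hJts_slice i θ z
      rw [hfun]
      have hFθ : DifferentiableAt ℝ (fun z ↦ F₁ z + θ * G z) y := (hF₁d y).add ((hGd y).const_mul θ)
      have hcomp : DifferentiableAt ℝ
          (fun z : E3 ↦ J i.succ (E4.ofTimeSpace (τ + (F₁ z + θ * G z)) z)) y :=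
        ((hJd i.succ _).hasFDerivAt.comp (f := fun z ↦ E4.ofTimeSpace (τ + (F₁ z + θ * G z)) z)
          y (E4.hasFDerivAt_graphMap hFθ.hasFDerivAt τ)).differentiableAt
      rw [Kerr.fderiv_mul_comp_graphMap (hGd y) hcomp i,
        Kerr.fderiv_comp_graphMap (J := J i.succ) (F := fun z ↦ F₁ z + θ * G z) hFθ τ
          (hJd i.succ _) i,
        Kerr.partialE3_add_const_mul (hF₁d y) (hGd y) θ i, ← hQ,
        show fderiv ℝ G y (EuclideanSpace.single i 1) = b i from hb i]
      simp only [ha, hb]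
    -- assemble
    rw [Fin.sum_univ_succ, htime, Fin.sum_univ_succ (f := fun μ ↦
      fderiv ℝ (J μ) (E4.ofTimeSpace (τ + (F₁ y + θ * G y)) y) (E4.basisVector μ)), ← hQ]
    simp only [hspace, Fin.sum_univ_three]
    ring
  -- ### the slab identity for `J̃` on `[0, 1] × E3`
  have hslab := integral_sub_eq_integral_divergence hJt1 zero_le_one hJt_zero
  -- ### identify the fluxes at `θ = 1` and `θ = 0`
  have hpF₂ : ∀ (y : E3) (i : Fin 3),
      Kerr.partialE3 F₂ y i = Kerr.partialE3 F₁ y i + Kerr.partialE3 G y i := by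
    intro y i
    have h := Kerr.partialE3_add_const_mul (hF₁d y) (hGd y) 1 i
    rw [← hF₂fun] at h
    simpa using h
  have hflux : ∀ (F : E3 → ℝ) (y : E3) (t : ℝ),
      ∑ μ, J μ (E4.ofTimeSpace t y) * Kerr.graphConormal F y μ =
        J 0 (E4.ofTimeSpace t y) -
          ∑ i : Fin 3, J i.succ (E4.ofTimeSpace t y) * Kerr.partialE3 F y i := by
    intro F y t
    rw [Fin.sum_univ_succ, Kerr.graphConormal_zero, mul_one, sub_eq_add_neg, ← Finset.sum_neg_distrib]
    refine congrArg _ (Finset.sum_congr rfl fun i _ ↦ ?_)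
    rw [Kerr.graphConormal_succ, mul_neg]
  have h1 : ∀ y : E3, Jt 0 (E4.ofTimeSpace 1 y) =
      ∑ μ, J μ (E4.ofTimeSpace (τ + F₂ y) y) * Kerr.graphConormal F₂ y μ := by
    intro y
    have ht : τ + (F₁ y + 1 * G y) = τ + F₂ y := by rw [hG]; ring
    rw [hflux, hJt0_slice, ht]
    simp only [hpF₂, one_mul]
  have h0 : ∀ y : E3, Jt 0 (E4.ofTimeSpace 0 y) =
      ∑ μ, J μ (E4.ofTimeSpace (τ + F₁ y) y) * Kerr.graphConormal F₁ y μ := by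
    intro y
    have ht : τ + (F₁ y + 0 * G y) = τ + F₁ y := by ring
    rw [hflux, hJt0_slice, ht]
    simp only [zero_mul, add_zero]
  -- ### conclude
  have hL1 : (∫ y, Jt 0 (E4.ofTimeSpace 1 y)) =
      ∫ y, ∑ μ, J μ (E4.ofTimeSpace (τ + F₂ y) y) * Kerr.graphConormal F₂ y μ :=
    congrArg (fun f : E3 → ℝ ↦ ∫ y, f y) (funext h1)
  have hL0 : (∫ y, Jt 0 (E4.ofTimeSpace 0 y)) =
      ∫ y, ∑ μ, J μ (E4.ofTimeSpace (τ + F₁ y) y) * Kerr.graphConormal F₁ y μ :=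
    congrArg (fun f : E3 → ℝ ↦ ∫ y, f y) (funext h0)
  rw [← hL1, ← hL0, hslab]
  refine setIntegral_congr_fun measurableSet_Ioc fun θ _ ↦ ?_
  exact congrArg (fun f : E3 → ℝ ↦ ∫ y, f y) (funext fun y ↦ hpiola θ y)

/-- **The divergence at the graph points of the family vanishes far out, weighted by the gap.**
For `C¹` components `J^μ` vanishing on the far part `{‖y‖ > ρ}` of the closed wedge
`{τ + F₁(y) ≤ t ≤ τ + F₂(y)}` between two continuous heights `F₁ ≤ F₂`, for `θ ∈ [0, 1]` and
`‖y‖ > ρ`: `(F₂ − F₁)(y) · ∂_v J^μ (τ + F₁(y) + θ(F₂ − F₁)(y), y) = 0` — where the gap is positive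
the graph point is a limit of points of the open far wedge, on which `J^μ ≡ 0`, and `∂J^μ` is
continuous. [folklore] -/
theorem gap_mul_fderiv_eq_zero_of_wedge {J : Fin 4 → E4 → ℝ}
    (hJ1 : ∀ μ, ContDiff ℝ 1 (J μ)) {F₁ F₂ : E3 → ℝ} (hF₁ : Continuous F₁)
    (hF₂ : Continuous F₂) (hle : ∀ y, F₁ y ≤ F₂ y) {τ ρ : ℝ}
    (hJ0 : ∀ μ (x : E4), ρ < E4.spatialNorm x → τ + F₁ (E4.spatial x) ≤ x 0 →
      x 0 ≤ τ + F₂ (E4.spatial x) → J μ x = 0)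
    (μ : Fin 4) {θ : ℝ} (hθ : θ ∈ Set.Icc (0 : ℝ) 1) {y : E3} (hy : ρ < ‖y‖) (v : E4) :
    (F₂ y - F₁ y) *
        fderiv ℝ (J μ) (E4.ofTimeSpace (τ + (F₁ y + θ * (F₂ y - F₁ y))) y) v = 0 := by
  rcases eq_or_lt_of_le (sub_nonneg.mpr (hle y)) with hgap | hgap
  · rw [← hgap, zero_mul]
  refine mul_eq_zero_of_right _ ?_
  -- the open far wedge, on which `J^μ`, hence `∂J^μ`, vanishes
  obtain ⟨V, hV⟩ : ∃ V : Set E4, V = {x | ρ < E4.spatialNorm x ∧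
      τ + F₁ (E4.spatial x) < x 0 ∧ x 0 < τ + F₂ (E4.spatial x)} := ⟨_, rfl⟩
  have hVopen : IsOpen V := by
    have hc0 : Continuous fun x : E4 ↦ x 0 := (E4.dx 0).continuous
    have hc1 : Continuous fun x : E4 ↦ τ + F₁ (E4.spatial x) :=
      continuous_const.add (hF₁.comp E4.spatial.continuous)
    have hc2 : Continuous fun x : E4 ↦ τ + F₂ (E4.spatial x) :=
      continuous_const.add (hF₂.comp E4.spatial.continuous)
    rw [hV]
    exact (isOpen_lt continuous_const E4.continuous_spatialNorm).inter
      ((isOpen_lt hc1 hc0).inter (isOpen_lt hc0 hc2))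
  have hdJV : ∀ x ∈ V, fderiv ℝ (J μ) x v = 0 := fun x hx ↦ by
    have hJV : ∀ z ∈ V, J μ z = 0 := fun z hz ↦ by
      rw [hV] at hz
      exact hJ0 μ z hz.1 hz.2.1.le hz.2.2.le
    simp [fderiv_eq_zero_of_forall_mem_eq_zero hVopen hJV hx]
  -- `ϑ ↦ ∂_v J^μ (graph point of ϑ)` is continuous and vanishes for `ϑ ∈ (0, 1)`
  have hPc : Continuous fun ϑ : ℝ ↦ E4.ofTimeSpace (τ + (F₁ y + ϑ * (F₂ y - F₁ y))) y :=
    continuous_iff_continuousAt.mpr fun ϑ ↦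
      (hasDerivAt_graphMap_param_id F₁ (fun z ↦ F₂ z - F₁ z) τ y ϑ).continuousAt
  have hcont : Continuous fun ϑ : ℝ ↦
      fderiv ℝ (J μ) (E4.ofTimeSpace (τ + (F₁ y + ϑ * (F₂ y - F₁ y))) y) v :=
    (((hJ1 μ).continuous_fderiv one_ne_zero).clm_apply continuous_const).comp hPc
  have hIoo : ∀ ϑ ∈ Set.Ioo (0 : ℝ) 1,
      fderiv ℝ (J μ) (E4.ofTimeSpace (τ + (F₁ y + ϑ * (F₂ y - F₁ y))) y) v = 0 := by
    intro ϑ hϑ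
    refine hdJV _ ?_
    rw [hV]
    refine ⟨by rw [E4.spatialNorm_ofTimeSpace]; exact hy, ?_, ?_⟩
    · rw [E4.spatial_ofTimeSpace, E4.ofTimeSpace_apply_zero]
      nlinarith [mul_pos hϑ.1 hgap]
    · rw [E4.spatial_ofTimeSpace, E4.ofTimeSpace_apply_zero]
      nlinarith [mul_lt_mul_of_pos_right hϑ.2 hgap]
  have hclos : θ ∈ closure (Set.Ioo (0 : ℝ) 1) := by
    rw [closure_Ioo zero_ne_one]
    exact hθ
  exact (isClosed_eq hcont continuous_const).closure_subset_iff.mpr hIoo hclos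

/-- **The integrated divergence identity between two graph hypersurfaces, space-time form**
(DRSR arXiv:1402.7034, §2.3.2, (ingeneralform)): under the hypotheses of
`graphFlux_sub_eq_integral_divergence`,
`∫ ∑_μ J^μ n^{F₂}_μ (τ + F₂(y), y) dy − ∫ ∑_μ J^μ n^{F₁}_μ (τ + F₁(y), y) dy
  = ∫ ( ∫_{t ∈ (τ + F₁(y), τ + F₂(y)]} (∑_μ ∂_μ J^μ)(t, y) dt ) dy`,
the integral of the coordinate divergence over the wedge between the graphs, `dVol = dt dy`
(Fubini on `(0, 1] × E3`, the integrand being continuous with support in `[0,1] × B̄_ρ` by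
`gap_mul_fderiv_eq_zero_of_wedge`, and the substitution `t = τ + F₁(y) + θ (F₂ − F₁)(y)`).
[cite: DafermosRodnianskiShlapentokhrothman2014, §2.3.2] -/
theorem graphFlux_sub_eq_integral_integral {J : Fin 4 → E4 → ℝ}
    (hJ1 : ∀ μ, ContDiff ℝ 1 (J μ)) {F₁ F₂ : E3 → ℝ} (hF₁ : ContDiff ℝ 2 F₁)
    (hF₂ : ContDiff ℝ 2 F₂) (hle : ∀ y, F₁ y ≤ F₂ y) {τ ρ : ℝ}
    (hJ0 : ∀ μ (x : E4), ρ < E4.spatialNorm x → τ + F₁ (E4.spatial x) ≤ x 0 →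
      x 0 ≤ τ + F₂ (E4.spatial x) → J μ x = 0) :
    (∫ y, ∑ μ, J μ (E4.ofTimeSpace (τ + F₂ y) y) * Kerr.graphConormal F₂ y μ) -
        ∫ y, ∑ μ, J μ (E4.ofTimeSpace (τ + F₁ y) y) * Kerr.graphConormal F₁ y μ =
      ∫ y, ∫ t in Set.Ioc (τ + F₁ y) (τ + F₂ y),
        ∑ μ, fderiv ℝ (J μ) (E4.ofTimeSpace t y) (E4.basisVector μ) := by
  rw [graphFlux_sub_eq_integral_divergence hJ1 hF₁ hF₂ hle hJ0]
  -- notation: the gap `G` and the divergence `g`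
  obtain ⟨G, hG⟩ : ∃ G : E3 → ℝ, ∀ y, G y = F₂ y - F₁ y := ⟨_, fun _ ↦ rfl⟩
  obtain ⟨g, hg⟩ : ∃ g : ℝ → E3 → ℝ, ∀ t y,
      g t y = ∑ μ, fderiv ℝ (J μ) (E4.ofTimeSpace t y) (E4.basisVector μ) := ⟨_, fun _ _ ↦ rfl⟩
  simp only [← hG, ← hg]
  have hGc : Continuous G := by
    rw [show G = fun y ↦ F₂ y - F₁ y from funext hG]
    exact hF₂.continuous.sub hF₁.continuous
  have hgc : Continuous fun p : ℝ × E3 ↦ g p.1 p.2 := by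
    have h : (fun p : ℝ × E3 ↦ g p.1 p.2) = fun p ↦
        ∑ μ, fderiv ℝ (J μ) (E4.ofTimeSpace p.1 p.2) (E4.basisVector μ) := funext fun p ↦ hg _ _
    rw [h]
    exact continuous_finsetSum _ fun μ _ ↦
      (((hJ1 μ).continuous_fderiv one_ne_zero).clm_apply continuous_const).comp
        E4.continuous_ofTimeSpace_uncurry
  -- the integrand of the `θ`-form, its continuity and its support
  obtain ⟨Φ, hΦ⟩ : ∃ Φ : ℝ → E3 → ℝ, ∀ θ y, Φ θ y = G y * g (τ + (F₁ y + θ * G y)) y :=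
    ⟨_, fun _ _ ↦ rfl⟩
  have hΦc : Continuous (Function.uncurry Φ) := by
    have h : Function.uncurry Φ = fun p : ℝ × E3 ↦ G p.2 *
        (fun q : ℝ × E3 ↦ g q.1 q.2) (τ + (F₁ p.2 + p.1 * G p.2), p.2) :=
      funext fun p ↦ hΦ _ _
    rw [h]
    refine (hGc.comp continuous_snd).mul (hgc.comp ?_)
    exact (continuous_const.add ((hF₁.continuous.comp continuous_snd).add
      (continuous_fst.mul (hGc.comp continuous_snd)))).prodMk continuous_snd
  have hΦ0 : ∀ θ ∈ Set.Icc (0 : ℝ) 1, ∀ y : E3, ρ < ‖y‖ → Φ θ y = 0 := by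
    intro θ hθ y hy
    rw [hΦ, hg, Finset.mul_sum]
    refine Finset.sum_eq_zero fun μ _ ↦ ?_
    rw [hG]
    exact gap_mul_fderiv_eq_zero_of_wedge hJ1 hF₁.continuous hF₂.continuous hle hJ0 μ hθ hy _
  -- ### Fubini on `(0, 1] × E3`
  have hK : IsCompact (Set.Icc (0 : ℝ) 1 ×ˢ closedBall (0 : E3) ρ) :=
    isCompact_Icc.prod (isCompact_closedBall _ _)
  have hIntK : IntegrableOn (Function.uncurry Φ) (Set.Icc (0 : ℝ) 1 ×ˢ closedBall (0 : E3) ρ)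
      ((volume : Measure ℝ).prod (volume : Measure E3)) := by
    rw [← Measure.volume_eq_prod]
    exact hΦc.continuousOn.integrableOn_compact hK
  have hIntIcc : IntegrableOn (Function.uncurry Φ) (Set.Icc (0 : ℝ) 1 ×ˢ (Set.univ : Set E3))
      ((volume : Measure ℝ).prod (volume : Measure E3)) := by
    refine hIntK.of_forall_sdiff_eq_zero (measurableSet_Icc.prod MeasurableSet.univ) ?_
    rintro ⟨θ, y⟩ ⟨⟨hθ, -⟩, hny⟩
    have hy : y ∉ closedBall (0 : E3) ρ := fun h ↦ hny ⟨hθ, h⟩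
    rw [mem_closedBall, dist_zero_right, not_le] at hy
    exact hΦ0 θ hθ y hy
  have hInt : Integrable (Function.uncurry Φ)
      ((volume.restrict (Set.Ioc (0 : ℝ) 1)).prod (volume : Measure E3)) := by
    have h := hIntIcc.mono_set (Set.prod_mono Set.Ioc_subset_Icc_self le_rfl)
    rw [IntegrableOn, ← Measure.prod_restrict, Measure.restrict_univ] at h
    exact h
  have hswap := integral_integral_swap hInt
  have hLHS : (∫ θ in Set.Ioc (0 : ℝ) 1, ∫ y, G y * g (τ + (F₁ y + θ * G y)) y) =
      ∫ θ in Set.Ioc (0 : ℝ) 1, ∫ y, Φ θ y := by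
    simp only [hΦ]
  rw [hLHS, hswap]
  -- ### the substitution `t = τ + F₁(y) + θ G(y)` in the inner integral
  refine congrArg (fun f : E3 → ℝ ↦ ∫ y, f y) (funext fun y ↦ ?_)
  simp only [hΦ]
  rcases eq_or_ne (G y) 0 with hGy | hGy
  · have hF : τ + F₂ y = τ + F₁ y := by have := hG y; linarith
    simp [hGy, hF]
  · have h01 : τ + F₁ y ≤ τ + F₂ y := by linarith [hle y]
    rw [← intervalIntegral.integral_of_le zero_le_one, ← intervalIntegral.integral_of_le h01]
    have harg : ∀ θ : ℝ, τ + (F₁ y + θ * G y) = G y * θ + (τ + F₁ y) := fun θ ↦ by ring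
    simp only [harg, intervalIntegral.integral_const_mul]
    rw [intervalIntegral.integral_comp_mul_add (fun t ↦ g t y) hGy (τ + F₁ y)]
    have hb : G y * 1 + (τ + F₁ y) = τ + F₂ y := by rw [hG]; ring
    rw [mul_zero, zero_add, hb, smul_eq_mul, mul_inv_cancel_left₀ hGy]

/-- **The divergence identity between two leaves of a graph foliation** (DRSR arXiv:1402.7034,
§2.3.2, (ingeneralform2) for currents supported away from the lateral boundaries): for a `C²`
height `F`, `h ≥ 0`, and a `C¹` current `J` vanishing on the far part `{‖y‖ > ρ}` of the closed
slab `{τ + F(y) ≤ t ≤ τ + h + F(y)}` between the leaves `Σ_τ = {t = τ + F}` and `Σ_{τ+h}`,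
`∫ ∑_μ J^μ n_μ (τ + h + F(y), y) dy − ∫ ∑_μ J^μ n_μ (τ + F(y), y) dy
  = ∫ ( ∫_{t ∈ (τ + F(y), τ + h + F(y)]} (∑_μ ∂_μ J^μ)(t, y) dt ) dy`, `n = dt − dF`.
[cite: DafermosRodnianskiShlapentokhrothman2014, §2.3.2] -/
theorem graphFlux_translate_sub_eq_integral_integral {J : Fin 4 → E4 → ℝ}
    (hJ1 : ∀ μ, ContDiff ℝ 1 (J μ)) {F : E3 → ℝ} (hF : ContDiff ℝ 2 F) {τ h ρ : ℝ}
    (hh : 0 ≤ h)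
    (hJ0 : ∀ μ (x : E4), ρ < E4.spatialNorm x → τ + F (E4.spatial x) ≤ x 0 →
      x 0 ≤ τ + h + F (E4.spatial x) → J μ x = 0) :
    (∫ y, ∑ μ, J μ (E4.ofTimeSpace (τ + h + F y) y) * Kerr.graphConormal F y μ) -
        ∫ y, ∑ μ, J μ (E4.ofTimeSpace (τ + F y) y) * Kerr.graphConormal F y μ =
      ∫ y, ∫ t in Set.Ioc (τ + F y) (τ + h + F y),
        ∑ μ, fderiv ℝ (J μ) (E4.ofTimeSpace t y) (E4.basisVector μ) := by
  have hF₂ : ContDiff ℝ 2 fun y ↦ h + F y := contDiff_const.add hF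
  have h2 := graphFlux_sub_eq_integral_integral hJ1 hF hF₂ (fun y ↦ by linarith) (τ := τ)
    (ρ := ρ) fun μ x hx h1 h2 ↦ hJ0 μ x hx h1 (by simpa [add_assoc] using h2)
  have hn : ∀ (y : E3) (μ : Fin 4),
      Kerr.graphConormal (fun y ↦ h + F y) y μ = Kerr.graphConormal F y μ := by
    intro y μ
    refine Fin.cases rfl (fun i ↦ ?_) μ
    simp only [Kerr.graphConormal_succ, Kerr.partialE3, fderiv_const_add]
  simp only [hn, ← add_assoc] at h2
  exact h2

end E4

end Literature.Geometry.Lorentzian
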